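import Summits.Ventures.CertifiedManyBodySolver.Upper.IntervalReaderEmbedLayout

/-!
# Ventures/CertifiedManyBodySolver — Upper/IntervalReaderEmbedWordSums.lean: the EMBED layout of `l3core-sgf`, II —
# the dilated operators' Rayleigh numerators ARE the `2ab`-site word sums (part 34 of the Theorem-H1′ package;
# part 33 `IntervalReaderEmbedLayout`, part 35 `IntervalReaderEmbedClaimNode`)

HONEST FRAMING: first certified bounds; not a superconductivity verdict; every number certified (two readers)
or labelled float.  A sourced-Hamiltonian upper is a certified variational ENERGY CEILING for
`H − μN − h(Δ_d + Δ_d†)` on one finite box together with windows of the SAME vector; it is never a sign of order and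
never an order-parameter word (LADDER v1.17 (i)).  This file is a DICTIONARY between two layouts of one reader; it
certifies no number and moves no row.

THIS FILE (spin side, the dilated lattice `Orb (Fin a ×ₗ Fin b)` read along a MONOTONE enumeration
`e′ : Fin N ≃ Orb (Fin a ×ₗ Fin b)` of its sites — the reader's `2ab` l3core sites in order):
* the tables of ird-3's automaton in the embed layout: hopping weights `dGammaHop (orbPullback e′ (dilMatrix M))`
  (part 21), the CROSS-site density weight `dilNN U e′` (`−U` between the dilated sites `(x,↑) < (x,↓)`, read at spin
  `0`), the on-site words `dilOnSite M U μ e′` (diagonal one-body + `U·n₀` on the `(x,↑)` sites + the constant `−μ·ab`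
  at the chain's site `0`) and `dilNumberOnSite a b e′` (`±n₀` by spin of the dilated site + the constant `ab`);
* `quadWordSum_eq_add_nn` (the `ν`-part of part 20's word sum separated), the closed forms `sum_dilNN_smul`,
  `sum_onSite_dilExtra`, and the two DICTIONARY identities **`inner_dilQuadratic_eq_quadWordSum`** (symmetric `M`):
  `⟨toSpinVec⁻¹Ψ′, Γ(dilOrb)(dΓ(M) − μ·ab·1 + U(N_↑ − Σ n_↑n_↓)) toSpinVec⁻¹Ψ′⟩
   = ⟨ψ, quadWordSum (dGammaHop (orbPullback e′ (dilMatrix M))) (dilNN U e′) (dilOnSite M U μ e′) ψ⟩` and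
  **`inner_dilNumber_eq_quadWordSum`** (the transformed number ↔ the channel-free word sum over `dilNumberOnSite`),
  for `Ψ′ k = ψ (k ∘ e′)` and ANY chain vector `ψ`.
By value (ird-3 / ref-2c dictionary, as for parts 19/22): `sgf_model.ModeQuadModel.dilated` maps mode `p` to mode `2p`
and `site_mpo ∘ mode_mpo` of the dilated model is `quadAutomaton (dGammaHop …) (dilNN …) (dilOnSite …)` on `2ab` sites
— every one-body pair and the `nn` pair of the transformed interaction are CROSS-site, the on-site words carry only
`ε_p·n`, `U·n` (on the `↑` modes) and the constant.
-/

noncomputable section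

-- The dilated orbital type `Orb (Orb Λ)` is a twice-nested `Lex` synonym; its `DecidableEq` / `Fintype` instance
-- terms exceed the default answer size of instance synthesis (they are found, but discarded), hence:
set_option synthInstance.maxSize 1024

open Matrix Finset WithLp
open scoped BigOperators ComplexOrder Matrix.Norms.L2Operator

namespace Summit.Ventures.CertifiedManyBodySolver.Upper.IntervalReader

open Literature.MathematicalPhysics.QuantumLattice
open Literature.MathematicalPhysics.QuantumLattice.JordanWigner
open Literature.MathematicalPhysics.QuantumLattice.JWEmbed
open Literature.MathematicalPhysics.QuantumLattice.TwoCluster (HasParity)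

/-! ## §W  The dilated lattice read along an enumeration: the `2ab`-site word sums -/

section WordSums

variable {Λ : Type*} [LinearOrder Λ] [Fintype Λ] {N : ℕ}

/-- A number operator of the site `i`, read on the chain along any bijection `e`. -/
theorem inner_toSpin_numberOp_site (e : Fin N ≃ Λ) (i : Λ) (σ : Fin 2) (ψ ψ' : TensorIndex (Fin N) 4 → ℂ) :
    star (fun k : TensorIndex Λ 4 => ψ (fun j => k (e j))) ⬝ᵥ
        (toSpin (numberOp i σ) *ᵥ fun k : TensorIndex Λ 4 => ψ' (fun j => k (e j))) =
      star ψ ⬝ᵥ ((onSite (e.symm i) (siteNumber σ) : Op (Fin N) 4) *ᵥ ψ') := by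
  obtain ⟨k, rfl⟩ := e.surjective i
  rw [toSpin_numberOp_eq_productOp, inner_productOp_compEquiv, update_comp_equiv, ← onSite_eq_productOp,
    Equiv.symm_apply_apply]

/-- A product of number operators of two DIFFERENT sites, read on the chain along any bijection `e`. -/
theorem inner_toSpin_numberOp_mul_numberOp_sites (e : Fin N ≃ Λ) {i i' : Λ} (hii' : i ≠ i') (σ σ' : Fin 2)
    (ψ ψ' : TensorIndex (Fin N) 4 → ℂ) :
    star (fun k : TensorIndex Λ 4 => ψ (fun j => k (e j))) ⬝ᵥ
        (toSpin (numberOp i σ * numberOp i' σ') *ᵥ fun k : TensorIndex Λ 4 => ψ' (fun j => k (e j))) =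
      star ψ ⬝ᵥ ((onSite (e.symm i) (siteNumber σ) * onSite (e.symm i') (siteNumber σ') : Op (Fin N) 4) *ᵥ ψ') := by
  obtain ⟨k, rfl⟩ := e.surjective i
  obtain ⟨k', rfl⟩ := e.surjective i'
  have hkk' : k ≠ k' := fun h => hii' (by rw [h])
  have hfam : (fun j => Function.update (Function.update (fun _ => (1 : Matrix (Fin 4) (Fin 4) ℂ)) (e k') (siteNumber σ'))
      (e k) (siteNumber σ) (e j)) =
      Function.update (Function.update (fun _ => (1 : Matrix (Fin 4) (Fin 4) ℂ)) k' (siteNumber σ')) k (siteNumber σ) := by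
    funext j
    simp only [Function.update_apply, e.injective.eq_iff]
  rw [map_mul, toSpin_numberOp, toSpin_numberOp, onSite_mul_onSite_eq_productOp hii', inner_productOp_compEquiv,
    hfam, ← onSite_mul_onSite_eq_productOp hkk', Equiv.symm_apply_apply, Equiv.symm_apply_apply]

/-- Word sums are additive in the density weights: the `ν`-part separated. -/
theorem quadWordSum_eq_add_nn (τ ν : Fin N → Fin 2 → Fin N → Fin 2 → ℂ) (V : Fin N → Matrix (Fin 4) (Fin 4) ℂ) :
    quadWordSum τ ν V = quadWordSum τ (fun _ _ _ _ => 0) V +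
      ∑ k, ∑ k', ∑ s : Fin 2, ∑ s' : Fin 2, if k < k' then
        ν k s k' s' • (onSite k (siteNumber s) * onSite k' (siteNumber s') : Op (Fin N) 4) else 0 := by
  rw [quadWordSum, quadWordSum, add_assoc]
  congr 1
  rw [← Finset.sum_add_distrib]
  refine Finset.sum_congr rfl fun k _ => ?_
  rw [← Finset.sum_add_distrib]
  refine Finset.sum_congr rfl fun k' _ => ?_
  rw [← Finset.sum_add_distrib]
  refine Finset.sum_congr rfl fun s _ => ?_
  rw [← Finset.sum_add_distrib]
  refine Finset.sum_congr rfl fun s' _ => ?_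
  split_ifs <;> simp

/-- A constant placed at the chain's site `0` sums to the constant (both vanish on the empty chain). -/
theorem sum_ite_val_zero' (c : ℂ) (hc : N = 0 → c = 0) :
    ∑ k : Fin N, (if (k : ℕ) = 0 then c else 0) = c := by
  by_cases hN : N = 0
  · subst hN
    rw [Finset.univ_eq_empty, Finset.sum_empty, hc rfl]
  · have h0 : 0 < N := Nat.pos_of_ne_zero hN
    rw [Finset.sum_eq_single (⟨0, h0⟩ : Fin N)]
    · simp
    · intro k _ hk
      rw [if_neg (fun h' => hk (Fin.ext h'))]
    · intro h'; exact absurd (Finset.mem_univ _) h'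

/-- `on_x 0 = 0`. -/
theorem onSite_zero_four (x : Λ) : (onSite x (0 : Matrix (Fin 4) (Fin 4) ℂ) : Op Λ 4) = 0 := by
  rw [← zero_smul ℂ (1 : Matrix (Fin 4) (Fin 4) ℂ), onSite_smul', zero_smul]

variable {a b : ℕ}

/-- **The cross-site density weights of the embed layout**: `−U` between the dilated sites `(x,↑) < (x,↓)` read at
spin `0` (the word `−U·n_{x↑}ñ_{x↓}` of the transformed interaction), zero otherwise. -/
def dilNN (U : ℝ) (e' : Fin N ≃ Orb (Fin a ×ₗ Fin b)) : Fin N → Fin 2 → Fin N → Fin 2 → ℂ :=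
  fun k s k' s' => if s = 0 ∧ s' = 0 ∧ (ofLex (e' k)).2 = 0 ∧ e' k' = orb (ofLex (e' k)).1 1 then -(U : ℂ) else 0

/-- **The on-site words of the embed layout** for `dΓ(M) − μ·ab·1 + U(N_↑ − Σ n_↑n_↓)`: the (diagonal) intra-site part of
`dΓ(dilMatrix M)`, `U • n₀` on the dilated sites `(x,↑)`, and the constant `−μ·ab` at the chain's site `0`. -/
def dilOnSite (M : Matrix (Orb (Fin a ×ₗ Fin b)) (Orb (Fin a ×ₗ Fin b)) ℂ) (U μ : ℝ)
    (e' : Fin N ≃ Orb (Fin a ×ₗ Fin b)) (k : Fin N) : Matrix (Fin 4) (Fin 4) ℂ :=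
  dGammaOnSite (orbPullback e' (dilMatrix M)) k +
    ((if (ofLex (e' k)).2 = 0 then (U : ℂ) • siteNumber 0 else 0) +
      if (k : ℕ) = 0 then (-((μ : ℂ) * ((a : ℂ) * (b : ℂ)))) • (1 : Matrix (Fin 4) (Fin 4) ℂ) else 0)

/-- **The on-site words of the embed layout for the transformed number** `ab·1 + Σ_x (n_{x↑} − n_{x↓})`: `+n₀` on the
dilated sites `(x,↑)`, `−n₀` on `(x,↓)`, and the constant `ab` at the chain's site `0`. -/
def dilNumberOnSite (a b : ℕ) (e' : Fin N ≃ Orb (Fin a ×ₗ Fin b)) (k : Fin N) : Matrix (Fin 4) (Fin 4) ℂ :=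
  (if (ofLex (e' k)).2 = 0 then siteNumber 0 else -siteNumber 0) +
    if (k : ℕ) = 0 then ((a : ℂ) * (b : ℂ)) • (1 : Matrix (Fin 4) (Fin 4) ℂ) else 0

/-- The chain is as long as the dilated lattice: `N = 0` forces `a·b = 0`. -/
theorem ab_cast_eq_zero_of_chain_empty (e' : Fin N ≃ Orb (Fin a ×ₗ Fin b)) (hN : N = 0) : (a : ℂ) * (b : ℂ) = 0 := by
  have hcard : Fintype.card (Orb (Fin a ×ₗ Fin b)) = N := by
    rw [← Fintype.card_congr e', Fintype.card_fin]
  have h2 : Fintype.card (Orb (Fin a ×ₗ Fin b)) = a * b * 2 := by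
    rw [← Fintype.card_congr (toLex : (Fin a ×ₗ Fin b) × Fin 2 ≃ Orb (Fin a ×ₗ Fin b)), Fintype.card_prod,
      ← Fintype.card_congr (toLex : Fin a × Fin b ≃ (Fin a ×ₗ Fin b)), Fintype.card_prod, Fintype.card_fin,
      Fintype.card_fin, Fintype.card_fin]
  rw [h2, hN] at hcard
  have hab : a * b = 0 := by omega
  exact_mod_cast (show ((a * b : ℕ) : ℂ) = 0 by rw [hab]; simp)

/-- A sum over the chain of a function of the dilated site is a sum over sites and spins of the box. -/
theorem sum_chain_eq_sum_site_spin {E : Type*} [AddCommMonoid E] (e' : Fin N ≃ Orb (Fin a ×ₗ Fin b))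
    (f : Fin N → E) : ∑ k, f k = ∑ x : Fin a ×ₗ Fin b, ∑ s : Fin 2, f (e'.symm (orb x s)) := by
  rw [← e'.symm.sum_comp f, sum_orb_eq_sum_site_spin]

/-- **The `ν`-part of the embed word sum in closed form**: one word `−U • (n₀)_{(x,↑)} (n₀)_{(x,↓)}` per box site. -/
theorem sum_dilNN_smul (U : ℝ) (e' : Fin N ≃ Orb (Fin a ×ₗ Fin b)) (he' : ∀ i j, e' i < e' j ↔ i < j) :
    (∑ k, ∑ k', ∑ s : Fin 2, ∑ s' : Fin 2, if k < k' then
        dilNN U e' k s k' s' • (onSite k (siteNumber s) * onSite k' (siteNumber s') : Op (Fin N) 4) else 0) =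
      ∑ x : Fin a ×ₗ Fin b, (-(U : ℂ)) •
        (onSite (e'.symm (orb x 0)) (siteNumber 0) * onSite (e'.symm (orb x 1)) (siteNumber 0) : Op (Fin N) 4) := by
  -- the summand: the condition of `dilNN` forces `k < k′`
  have hterm : ∀ (k k' : Fin N) (s s' : Fin 2), (if k < k' then
      dilNN U e' k s k' s' • (onSite k (siteNumber s) * onSite k' (siteNumber s') : Op (Fin N) 4) else 0) =
      if s = 0 ∧ s' = 0 ∧ (ofLex (e' k)).2 = 0 ∧ e' k' = orb (ofLex (e' k)).1 1 then
        (-(U : ℂ)) • (onSite k (siteNumber 0) * onSite k' (siteNumber 0) : Op (Fin N) 4) else 0 := by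
    intro k k' s s'
    by_cases hc : s = 0 ∧ s' = 0 ∧ (ofLex (e' k)).2 = 0 ∧ e' k' = orb (ofLex (e' k)).1 1
    · obtain ⟨rfl, rfl, h2, h3⟩ := hc
      have hk : e' k = orb (ofLex (e' k)).1 0 := by
        rw [orb, ← h2]; rfl
      have hlt : k < k' := by
        rw [← he', h3, hk]
        show toLex ((ofLex (e' k)).1, (0 : Fin 2)) < toLex ((ofLex (e' k)).1, (1 : Fin 2))
        rw [Prod.Lex.toLex_lt_toLex]
        exact Or.inr ⟨rfl, by show (0 : Fin 2) < 1; decide⟩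
      rw [if_pos hlt, dilNN, if_pos ⟨rfl, rfl, h2, h3⟩, if_pos ⟨rfl, rfl, h2, h3⟩]
    · rw [if_neg hc, dilNN, if_neg hc, zero_smul, ite_self]
  simp only [hterm]
  -- the spin sums collapse to `s = s′ = 0`
  have hspin : ∀ k k' : Fin N, (∑ s : Fin 2, ∑ s' : Fin 2,
      if s = 0 ∧ s' = 0 ∧ (ofLex (e' k)).2 = 0 ∧ e' k' = orb (ofLex (e' k)).1 1 then
        (-(U : ℂ)) • (onSite k (siteNumber 0) * onSite k' (siteNumber 0) : Op (Fin N) 4) else 0) =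
      if (ofLex (e' k)).2 = 0 ∧ e' k' = orb (ofLex (e' k)).1 1 then
        (-(U : ℂ)) • (onSite k (siteNumber 0) * onSite k' (siteNumber 0) : Op (Fin N) 4) else 0 := by
    intro k k'
    simp [Fin.sum_univ_two]
  simp only [hspin]
  -- the partner sum collapses to `k′ = e′⁻¹ (x, ↓)`
  have hpartner : ∀ k : Fin N, (∑ k', if (ofLex (e' k)).2 = 0 ∧ e' k' = orb (ofLex (e' k)).1 1 then
        (-(U : ℂ)) • (onSite k (siteNumber 0) * onSite k' (siteNumber 0) : Op (Fin N) 4) else 0) =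
      if (ofLex (e' k)).2 = 0 then (-(U : ℂ)) •
        (onSite k (siteNumber 0) * onSite (e'.symm (orb (ofLex (e' k)).1 1)) (siteNumber 0) : Op (Fin N) 4) else 0 := by
    intro k
    by_cases hP : (ofLex (e' k)).2 = 0
    · simp only [hP, true_and, if_true]
      rw [Finset.sum_eq_single (e'.symm (orb (ofLex (e' k)).1 1))]
      · rw [if_pos (e'.apply_symm_apply _)]
      · intro k' _ hk'
        rw [if_neg (fun h => hk' (by rw [← h, Equiv.symm_apply_apply]))]
      · intro h; exact absurd (Finset.mem_univ _) h
    · simp [hP]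
  simp only [hpartner]
  -- read the chain sum as a sum over box sites and spins
  rw [sum_chain_eq_sum_site_spin e']
  refine Finset.sum_congr rfl fun x _ => ?_
  have h0 : (ofLex (e' (e'.symm (orb x 0)))).2 = 0 := by rw [Equiv.apply_symm_apply]; rfl
  have h1 : ¬ (ofLex (e' (e'.symm (orb x 1)))).2 = 0 := by
    rw [Equiv.apply_symm_apply]; show ¬ ((1 : Fin 2) = 0); decide
  have hx : (ofLex (e' (e'.symm (orb x 0)))).1 = x := by rw [Equiv.apply_symm_apply]; rfl
  rw [Fin.sum_univ_two, if_pos h0, if_neg h1, add_zero, hx]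

/-- **The extra on-site words of the embed layout in closed form.** -/
theorem sum_onSite_dilExtra (U μ : ℝ) (e' : Fin N ≃ Orb (Fin a ×ₗ Fin b)) :
    (∑ k : Fin N, (onSite k ((if (ofLex (e' k)).2 = 0 then (U : ℂ) • siteNumber 0 else 0) +
        if (k : ℕ) = 0 then (-((μ : ℂ) * ((a : ℂ) * (b : ℂ)))) • (1 : Matrix (Fin 4) (Fin 4) ℂ) else 0) : Op (Fin N) 4)) =
      (∑ x : Fin a ×ₗ Fin b, (U : ℂ) • (onSite (e'.symm (orb x 0)) (siteNumber 0) : Op (Fin N) 4)) +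
        (-((μ : ℂ) * ((a : ℂ) * (b : ℂ)))) • (1 : Op (Fin N) 4) := by
  simp only [onSite_add', Finset.sum_add_distrib]
  congr 1
  · rw [sum_chain_eq_sum_site_spin e']
    refine Finset.sum_congr rfl fun x _ => ?_
    have h0 : (ofLex (e' (e'.symm (orb x 0)))).2 = 0 := by rw [Equiv.apply_symm_apply]; rfl
    have h1 : ¬ (ofLex (e' (e'.symm (orb x 1)))).2 = 0 := by
      rw [Equiv.apply_symm_apply]; show ¬ ((1 : Fin 2) = 0); decide
    rw [Fin.sum_univ_two, if_pos h0, if_neg h1, onSite_zero_four, add_zero, onSite_smul']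
  · have h1 : ∀ k : Fin N, (onSite k (if (k : ℕ) = 0 then (-((μ : ℂ) * ((a : ℂ) * (b : ℂ)))) •
        (1 : Matrix (Fin 4) (Fin 4) ℂ) else 0) : Op (Fin N) 4) =
        (if (k : ℕ) = 0 then (-((μ : ℂ) * ((a : ℂ) * (b : ℂ)))) else 0) • (1 : Op (Fin N) 4) := by
      intro k
      split_ifs
      · rw [onSite_smul', onSite_one']
      · rw [zero_smul]; exact onSite_zero_four k
    simp only [h1]
    rw [← Finset.sum_smul, sum_ite_val_zero' (-((μ : ℂ) * ((a : ℂ) * (b : ℂ))))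
      (fun hN => by rw [ab_cast_eq_zero_of_chain_empty e' hN]; ring)]

/-- **THE DILATED QUADRATIC OPERATOR'S RAYLEIGH NUMERATOR IS THE EMBED WORD SUM'S MATRIX ELEMENT** (symmetric
`M`, monotone enumeration `e′` of the dilated sites): for `Ψ′ k = ψ (k ∘ e′)`,
`⟨toSpinVec⁻¹Ψ′, (dΓ(dilMatrix M) − μ·ab·1 + U(Σ_x n_{(x↑),0} − Σ_x n_{(x↑),0} n_{(x↓),0})) toSpinVec⁻¹Ψ′⟩
 = ⟨ψ, quadWordSum (dGammaHop (orbPullback e′ (dilMatrix M))) (dilNN U e′) (dilOnSite M U μ e′) ψ⟩`. -/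
theorem inner_dilQuadratic_eq_quadWordSum (M : Matrix (Orb (Fin a ×ₗ Fin b)) (Orb (Fin a ×ₗ Fin b)) ℂ)
    (hM : ∀ i j, M i j = M j i) (U μ : ℝ) (e' : Fin N ≃ Orb (Fin a ×ₗ Fin b))
    (he' : ∀ i j, e' i < e' j ↔ i < j) (ψ : TensorIndex (Fin N) 4 → ℂ) :
    let Ψ' : TensorIndex (Orb (Fin a ×ₗ Fin b)) 4 → ℂ := fun k => ψ (fun j => k (e' j))
    star (toSpinVec.symm Ψ') ⬝ᵥ
        ((dGamma (dilMatrix M) - ((μ : ℂ) * ((a : ℂ) * (b : ℂ))) •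
            (1 : Matrix (Finset (Orb (Orb (Fin a ×ₗ Fin b)))) (Finset (Orb (Orb (Fin a ×ₗ Fin b)))) ℂ) +
          (U : ℂ) • ((∑ x : Fin a ×ₗ Fin b, numberOp (orb x 0) 0) -
            ∑ x : Fin a ×ₗ Fin b, numberOp (orb x 0) 0 * numberOp (orb x 1) 0)) *ᵥ toSpinVec.symm Ψ') =
      star ψ ⬝ᵥ (quadWordSum (dGammaHop (orbPullback e' (dilMatrix M))) (dilNN U e') (dilOnSite M U μ e') *ᵥ ψ) := by
  intro Ψ'
  have hconv : ∀ X : Matrix (Finset (Orb (Orb (Fin a ×ₗ Fin b)))) (Finset (Orb (Orb (Fin a ×ₗ Fin b)))) ℂ,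
      star (toSpinVec.symm Ψ') ⬝ᵥ (X *ᵥ toSpinVec.symm Ψ') = star Ψ' ⬝ᵥ (toSpin X *ᵥ Ψ') := fun X => by
    rw [← star_toSpinVec_dotProduct, ← toSpin_mulVec, LinearEquiv.apply_symm_apply]
  have hnorm : star (toSpinVec.symm Ψ') ⬝ᵥ toSpinVec.symm Ψ' = star Ψ' ⬝ᵥ Ψ' := by
    rw [← star_toSpinVec_dotProduct, LinearEquiv.apply_symm_apply]
  rw [add_mulVec, sub_mulVec, dotProduct_add, dotProduct_sub, smul_mulVec, one_mulVec, dotProduct_smul, smul_eq_mul,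
    smul_mulVec, dotProduct_smul, smul_eq_mul, sub_mulVec, dotProduct_sub, Matrix.sum_mulVec, Matrix.sum_mulVec,
    dotProduct_sum, dotProduct_sum]
  simp only [hconv, hnorm]
  -- (1) the one-body term on the chain; (2) the norm
  rw [inner_toSpin_dGamma_relabel e' he', star_compEquiv_dotProduct,
    toSpin_dGamma_eq_quadWordSum _ (orbPullback_symm e' _ (dilMatrix_symm M hM))]
  -- (3) the spin-`0` densities of the dilated sites `(x,↑)`; (4) the cross-site densities
  have hup : (∑ x : Fin a ×ₗ Fin b, star Ψ' ⬝ᵥ (toSpin (numberOp (orb x 0) 0) *ᵥ Ψ')) =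
      ∑ x : Fin a ×ₗ Fin b, star ψ ⬝ᵥ ((onSite (e'.symm (orb x 0)) (siteNumber 0) : Op (Fin N) 4) *ᵥ ψ) :=
    Finset.sum_congr rfl fun x _ => inner_toSpin_numberOp_site e' (orb x 0) 0 ψ ψ
  have hne : ∀ x : Fin a ×ₗ Fin b, orb x (0 : Fin 2) ≠ orb x 1 := fun x h => by
    have := (orb_eq_orb_iff.mp h).2
    exact absurd this (by decide)
  have hnn : (∑ x : Fin a ×ₗ Fin b, star Ψ' ⬝ᵥ (toSpin (numberOp (orb x 0) 0 * numberOp (orb x 1) 0) *ᵥ Ψ')) =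
      ∑ x : Fin a ×ₗ Fin b, star ψ ⬝ᵥ ((onSite (e'.symm (orb x 0)) (siteNumber 0) *
        onSite (e'.symm (orb x 1)) (siteNumber 0) : Op (Fin N) 4) *ᵥ ψ) :=
    Finset.sum_congr rfl fun x _ => inner_toSpin_numberOp_mul_numberOp_sites e' (hne x) 0 0 ψ ψ
  rw [hup, hnn]
  -- the word sum: split the on-site words and the density weights, then close both extra sums
  have hV : dilOnSite M U μ e' = fun k => dGammaOnSite (orbPullback e' (dilMatrix M)) k +
      ((if (ofLex (e' k)).2 = 0 then (U : ℂ) • siteNumber 0 else 0) +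
        if (k : ℕ) = 0 then (-((μ : ℂ) * ((a : ℂ) * (b : ℂ)))) • (1 : Matrix (Fin 4) (Fin 4) ℂ) else 0) := rfl
  rw [hV, quadWordSum_add_onSite, quadWordSum_eq_add_nn (dGammaHop (orbPullback e' (dilMatrix M))) (dilNN U e'),
    sum_dilNN_smul U e' he', sum_onSite_dilExtra U μ e']
  simp only [add_mulVec, dotProduct_add, Matrix.sum_mulVec, dotProduct_sum, smul_mulVec, dotProduct_smul, smul_eq_mul,
    one_mulVec, ← Finset.mul_sum]
  ring

/-- **THE DILATED NUMBER'S RAYLEIGH NUMERATOR IS THE CHANNEL-FREE EMBED WORD SUM'S MATRIX ELEMENT**: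
`⟨toSpinVec⁻¹Ψ′, (ab·1 + Σ_x (n_{(x↑),0} − n_{(x↓),0})) toSpinVec⁻¹Ψ′⟩ = ⟨ψ, quadWordSum 0 0 (dilNumberOnSite a b e′) ψ⟩`. -/
theorem inner_dilNumber_eq_quadWordSum (e' : Fin N ≃ Orb (Fin a ×ₗ Fin b)) (ψ : TensorIndex (Fin N) 4 → ℂ) :
    let Ψ' : TensorIndex (Orb (Fin a ×ₗ Fin b)) 4 → ℂ := fun k => ψ (fun j => k (e' j))
    star (toSpinVec.symm Ψ') ⬝ᵥ
        ((((Fintype.card (Fin a ×ₗ Fin b) : ℂ)) •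
              (1 : Matrix (Finset (Orb (Orb (Fin a ×ₗ Fin b)))) (Finset (Orb (Orb (Fin a ×ₗ Fin b)))) ℂ) +
            ∑ x : Fin a ×ₗ Fin b, (numberOp (orb x 0) 0 - numberOp (orb x 1) 0)) *ᵥ toSpinVec.symm Ψ') =
      star ψ ⬝ᵥ (quadWordSum (fun _ _ _ _ => 0) (fun _ _ _ _ => 0) (dilNumberOnSite a b e') *ᵥ ψ) := by
  intro Ψ'
  have hconv : ∀ X : Matrix (Finset (Orb (Orb (Fin a ×ₗ Fin b)))) (Finset (Orb (Orb (Fin a ×ₗ Fin b)))) ℂ,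
      star (toSpinVec.symm Ψ') ⬝ᵥ (X *ᵥ toSpinVec.symm Ψ') = star Ψ' ⬝ᵥ (toSpin X *ᵥ Ψ') := fun X => by
    rw [← star_toSpinVec_dotProduct, ← toSpin_mulVec, LinearEquiv.apply_symm_apply]
  have hnorm : star (toSpinVec.symm Ψ') ⬝ᵥ toSpinVec.symm Ψ' = star Ψ' ⬝ᵥ Ψ' := by
    rw [← star_toSpinVec_dotProduct, LinearEquiv.apply_symm_apply]
  have hcard : (Fintype.card (Fin a ×ₗ Fin b) : ℂ) = (a : ℂ) * (b : ℂ) := by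
    simp [Lex, Fintype.card_prod]
  rw [add_mulVec, dotProduct_add, smul_mulVec, one_mulVec, dotProduct_smul, smul_eq_mul, Matrix.sum_mulVec,
    dotProduct_sum, hnorm, hcard, star_compEquiv_dotProduct]
  simp only [sub_mulVec, dotProduct_sub, hconv]
  have hnum : ∀ σ : Fin 2, (∑ x : Fin a ×ₗ Fin b, star Ψ' ⬝ᵥ (toSpin (numberOp (orb x σ) 0) *ᵥ Ψ')) =
      ∑ x : Fin a ×ₗ Fin b, star ψ ⬝ᵥ ((onSite (e'.symm (orb x σ)) (siteNumber 0) : Op (Fin N) 4) *ᵥ ψ) :=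
    fun σ => Finset.sum_congr rfl fun x _ => inner_toSpin_numberOp_site e' (orb x σ) 0 ψ ψ
  rw [Finset.sum_sub_distrib, hnum 0, hnum 1]
  -- the word sum: no channels, on-site words only
  have hW : quadWordSum (fun _ _ _ _ => (0 : ℂ)) (fun _ _ _ _ => (0 : ℂ)) (dilNumberOnSite a b e') =
      ∑ k : Fin N, onSite k (dilNumberOnSite a b e' k) := by
    rw [quadWordSum]
    simp
  have hsplit : (∑ k : Fin N, (onSite k (dilNumberOnSite a b e' k) : Op (Fin N) 4)) =
      (∑ x : Fin a ×ₗ Fin b, ((onSite (e'.symm (orb x 0)) (siteNumber 0) : Op (Fin N) 4) -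
        onSite (e'.symm (orb x 1)) (siteNumber 0))) + ((a : ℂ) * (b : ℂ)) • (1 : Op (Fin N) 4) := by
    simp only [dilNumberOnSite, onSite_add', Finset.sum_add_distrib]
    congr 1
    · rw [sum_chain_eq_sum_site_spin e']
      refine Finset.sum_congr rfl fun x _ => ?_
      have h0 : (ofLex (e' (e'.symm (orb x 0)))).2 = 0 := by rw [Equiv.apply_symm_apply]; rfl
      have h1 : ¬ (ofLex (e' (e'.symm (orb x 1)))).2 = 0 := by
        rw [Equiv.apply_symm_apply]; show ¬ ((1 : Fin 2) = 0); decide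
      rw [Fin.sum_univ_two, if_pos h0, if_neg h1, onSite_neg', sub_eq_add_neg]
    · have h1 : ∀ k : Fin N, (onSite k (if (k : ℕ) = 0 then ((a : ℂ) * (b : ℂ)) •
          (1 : Matrix (Fin 4) (Fin 4) ℂ) else 0) : Op (Fin N) 4) =
          (if (k : ℕ) = 0 then ((a : ℂ) * (b : ℂ)) else 0) • (1 : Op (Fin N) 4) := by
        intro k
        split_ifs
        · rw [onSite_smul', onSite_one']
        · rw [zero_smul]; exact onSite_zero_four k
      simp only [h1]
      rw [← Finset.sum_smul, sum_ite_val_zero' ((a : ℂ) * (b : ℂ)) (fun hN => ab_cast_eq_zero_of_chain_empty e' hN)]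
  rw [hW, hsplit]
  simp only [add_mulVec, sub_mulVec, dotProduct_add, dotProduct_sub, Matrix.sum_mulVec, dotProduct_sum, smul_mulVec,
    dotProduct_smul, smul_eq_mul, one_mulVec, Finset.sum_sub_distrib]
  ring

end WordSums

end Summit.Ventures.CertifiedManyBodySolver.Upper.IntervalReader

end
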